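import Literature.Topology.Euclidean.BrouwerFixedPoint
import Literature.Topology.FourManifolds.NullImages
import Mathlib.Analysis.InnerProductSpace.PiL2
import Mathlib.Topology.OpenPartialHomeomorph.Basic
import HarnessLib

/-!
# General position with respect to a point: maps of dimension `< n` miss the centre of a chart

The simplest general-position statement of the engulfing proofs, in the form needed to make
the homotopies of the connectivity hypotheses of Rushing's Topological Engulfing Theorem 4.12.1
avoid the core balls (T. B. Rushing, *Topological embeddings* (1973), §1.6.D "General position",
and the uses "by a relative general position approximation argument" in §4.12): a continuous map
`H : P → Y` from a finite-dimensional real normed space `P` with `dim P < n` into a Hausdorff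
space carrying an open cell `Φ : ℝⁿ → Y` can be changed, only at points mapping into the chart
ball `Φ(B_R)` and only within the image of the chart, to a continuous map missing the centre
`Φ 0` on a given compact set (`exists_perturbation_forall_ne`).

We argue by measure instead of polyhedra: in the chart the map is approximated on the compact
set by a smooth map (mollification — the tree's
`Literature.Topology.Euclidean.Brouwer.exists_contDiff_approx`), whose image is Lebesgue-null
by the easy case of Sard's theorem (the tree's `addHaar_image_eq_zero_of_finrank_lt`,
`NullImages.lean`), hence omits small vectors (`exists_norm_lt_not_mem_image`); translating by
such a vector and cutting off radially (`innerCutoff`) gives the perturbation; the passage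
between `Y` and the chart is the continuous collapse `chartCollapse` (`Φ⁻¹` cut off near the
edge of a chart ball by the clamp `clampCutoff`).

Everything is proved; the file introduces no named fact (its definitions `clampCutoff`,
`chartCollapse`, `innerCutoff` have bodies).

## References

* T. B. Rushing, *Topological embeddings*, Pure and Applied Mathematics 52, Academic Press
  (1973), §1.6.D (general position) and §4.12. [Rushing1973]
-/

open Set Function Metric Topology MeasureTheory
open scoped Convolution

noncomputable section

namespace Literature.Topology.FourManifolds

variable {n : ℕ} {Y : Type*}

/-! ### §1 A radial cut-off and the collapse of a chart onto its model -/

/-- The piecewise-linear one-variable cut-off `u ↦ clamp_{[0,1]} (R + 1 - u)`: `1` for `u ≤ R`,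
`0` for `u ≥ R + 1` (a clamp, not the smooth radial cut-offs `radialCutoff` of
`Literature.Analysis.FluidPDE` / `…KineticTheory`). [folklore] -/
def clampCutoff (R u : ℝ) : ℝ := max 0 (min 1 (R + 1 - u))

/-- Continuity of the cut-off. [folklore] -/
theorem continuous_clampCutoff (R : ℝ) : Continuous (clampCutoff R) :=
  continuous_const.max (continuous_const.min (continuous_const.sub continuous_id))

/-- The cut-off is `1` up to `R`. [folklore] -/
theorem clampCutoff_of_le {R u : ℝ} (h : u ≤ R) : clampCutoff R u = 1 := by
  unfold clampCutoff
  rw [min_eq_left (by linarith), max_eq_right zero_le_one]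

/-- The cut-off vanishes from `R + 1` on. [folklore] -/
theorem clampCutoff_of_ge {R u : ℝ} (h : R + 1 ≤ u) : clampCutoff R u = 0 := by
  unfold clampCutoff
  rw [min_eq_right (by linarith), max_eq_left (by linarith)]

/-- **Collapse of a chart onto its model.** For an open cell `Φ : ℝⁿ → Y` and a radius `R`, the
map `Y → ℝⁿ` which is `Φ⁻¹` cut off radially between the radii `R` and `R + 1` on the image of
`Φ` and `0` elsewhere; it is continuous on all of `Y` (`continuous_chartCollapse`) and inverts `Φ`
on `Φ(B̄_R)` (`chartCollapse_apply_of_norm_le`). [folklore] -/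
def chartCollapse (Φ : EuclideanSpace ℝ (Fin n) → Y) (R : ℝ) (y : Y) : EuclideanSpace ℝ (Fin n) :=
  by classical exact if h : ∃ x, Φ x = y then clampCutoff R ‖h.choose‖ • h.choose else 0

variable {Φ : EuclideanSpace ℝ (Fin n) → Y} {R : ℝ}

/-- The collapse on the image of the chart. [folklore] -/
theorem chartCollapse_apply_image (hΦ : Injective Φ) (x : EuclideanSpace ℝ (Fin n)) :
    chartCollapse Φ R (Φ x) = clampCutoff R ‖x‖ • x := by
  have h : ∃ x', Φ x' = Φ x := ⟨x, rfl⟩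
  have hc : h.choose = x := hΦ h.choose_spec
  simp only [chartCollapse, dif_pos h, hc]

/-- The collapse inverts the chart on the closed `R`-ball. [folklore] -/
theorem chartCollapse_apply_of_norm_le (hΦ : Injective Φ) {x : EuclideanSpace ℝ (Fin n)}
    (hx : ‖x‖ ≤ R) : chartCollapse Φ R (Φ x) = x := by
  rw [chartCollapse_apply_image hΦ, clampCutoff_of_le hx, one_smul]

/-- The collapse vanishes off the image of the chart. [folklore] -/
theorem chartCollapse_of_not_mem {y : Y} (hy : y ∉ range Φ) : chartCollapse Φ R y = 0 := by
  have h : ¬ ∃ x, Φ x = y := fun ⟨x, hx⟩ => hy ⟨x, hx⟩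
  simp only [chartCollapse, dif_neg h]

/-- The collapse vanishes off the image of the closed `(R + 1)`-ball. [folklore] -/
theorem chartCollapse_of_not_mem_image (hΦ : Injective Φ) {y : Y}
    (hy : y ∉ Φ '' closedBall 0 (R + 1)) : chartCollapse Φ R y = 0 := by
  by_cases hyr : y ∈ range Φ
  · obtain ⟨x, rfl⟩ := hyr
    have hx : R + 1 ≤ ‖x‖ := by
      by_contra hlt
      exact hy ⟨x, mem_closedBall_zero_iff.2 (le_of_not_ge hlt), rfl⟩
    rw [chartCollapse_apply_image hΦ, clampCutoff_of_ge hx, zero_smul]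
  · exact chartCollapse_of_not_mem hyr

variable [TopologicalSpace Y]

/-- **The collapse is continuous** (Hausdorff `Y`): near the image of the chart it is a
continuous function of the chart coordinate, and it vanishes on the open complement of the
compact `Φ(B̄_{R+1})`. [folklore] -/
theorem continuous_chartCollapse [T2Space Y] (hΦ : IsOpenEmbedding Φ) (R : ℝ) :
    Continuous (chartCollapse Φ R) := by
  rw [continuous_iff_continuousAt]
  intro y
  by_cases hyr : y ∈ range Φ
  · obtain ⟨x, rfl⟩ := hyr
    have h1 : Continuous (fun x : EuclideanSpace ℝ (Fin n) => clampCutoff R ‖x‖ • x) :=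
      ((continuous_clampCutoff R).comp continuous_norm).smul continuous_id
    have h2 : Filter.Tendsto (chartCollapse Φ R ∘ Φ) (𝓝 x) (𝓝 (chartCollapse Φ R (Φ x))) := by
      have : chartCollapse Φ R ∘ Φ = fun x => clampCutoff R ‖x‖ • x :=
        funext fun z => chartCollapse_apply_image hΦ.injective z
      rw [this, chartCollapse_apply_image hΦ.injective]
      exact h1.continuousAt
    rw [ContinuousAt, ← hΦ.map_nhds_eq x]
    exact Filter.tendsto_map' h2
  · have hy : y ∉ Φ '' closedBall 0 (R + 1) := fun h => hyr (image_subset_range _ _ h)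
    have hopen : IsOpen (Φ '' closedBall 0 (R + 1))ᶜ :=
      ((isCompact_closedBall 0 (R + 1)).image hΦ.continuous).isClosed.isOpen_compl
    have : chartCollapse Φ R =ᶠ[𝓝 y] fun _ => 0 := by
      filter_upwards [hopen.mem_nhds hy] with z hz
      exact chartCollapse_of_not_mem_image hΦ.injective hz
    exact (continuousAt_congr this).2 continuousAt_const

/-! ### §2 Images of lower-dimensional spaces under differentiable maps are null -/

/-- **A differentiable map from a space of dimension `< n` into `ℝⁿ` misses points arbitrarily
close to `0`**: its image is Lebesgue-null (easy Sard, the tree's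
`addHaar_image_eq_zero_of_finrank_lt`, `NullImages.lean`), so it omits a point of every ball
(`exists_mem_notMem_of_measure_zero`). [folklore] -/
theorem exists_norm_lt_not_mem_image {P : Type*} [NormedAddCommGroup P] [NormedSpace ℝ P]
    [FiniteDimensional ℝ P] {q : P → EuclideanSpace ℝ (Fin n)} (hq : Differentiable ℝ q)
    (hdim : Module.finrank ℝ P < n) (S : Set P) {δ : ℝ} (hδ : 0 < δ) :
    ∃ v : EuclideanSpace ℝ (Fin n), ‖v‖ < δ ∧ v ∉ q '' S := by
  have hnull : (Measure.addHaar : Measure (EuclideanSpace ℝ (Fin n))) (q '' S) = 0 :=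
    addHaar_image_eq_zero_of_finrank_lt _ (by rwa [finrank_euclideanSpace_fin]) hq.differentiableOn
  obtain ⟨v, hv, hvS⟩ := exists_mem_notMem_of_measure_zero _ isOpen_ball
    (nonempty_ball.2 hδ : (ball (0 : EuclideanSpace ℝ (Fin n)) δ).Nonempty) hnull
  exact ⟨v, mem_ball_zero_iff.1 hv, hvS⟩

/-! ### §3 Perturbing a map off the centre of a chart -/

/-- The cut-off `θ`: `1` on `B̄_{R/4}`, `0` off `B_{R/2}`. [folklore] -/
def innerCutoff (R : ℝ) (x : EuclideanSpace ℝ (Fin n)) : ℝ := max 0 (min 1 (2 - 4 * ‖x‖ / R))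

/-- Continuity of `innerCutoff`. [folklore] -/
theorem continuous_innerCutoff (R : ℝ) : Continuous (innerCutoff (n := n) R) :=
  continuous_const.max (continuous_const.min
    (continuous_const.sub ((continuous_const.mul continuous_norm).div_const R)))

/-- Bounds `0 ≤ θ ≤ 1`. [folklore] -/
theorem innerCutoff_mem_Icc (R : ℝ) (x : EuclideanSpace ℝ (Fin n)) : innerCutoff R x ∈ Icc (0 : ℝ) 1 :=
  ⟨le_max_left _ _, max_le zero_le_one (min_le_left _ _)⟩

/-- `θ = 1` on the closed `R/4`-ball. [folklore] -/
theorem innerCutoff_of_le (hR : 0 < R) {x : EuclideanSpace ℝ (Fin n)} (hx : ‖x‖ ≤ R / 4) :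
    innerCutoff R x = 1 := by
  unfold innerCutoff
  have : 4 * ‖x‖ / R ≤ 1 := by
    rw [div_le_one hR]
    linarith
  rw [min_eq_left (by linarith), max_eq_right zero_le_one]

/-- `θ = 0` off the open `R/2`-ball. [folklore] -/
theorem innerCutoff_of_ge (hR : 0 < R) {x : EuclideanSpace ℝ (Fin n)} (hx : R / 2 ≤ ‖x‖) :
    innerCutoff R x = 0 := by
  unfold innerCutoff
  have : 2 ≤ 4 * ‖x‖ / R := by
    rw [le_div_iff₀ hR]
    linarith
  rw [min_eq_right (by linarith), max_eq_left (by linarith)]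

/-- **General position with respect to a point.** Let `Φ : ℝⁿ → Y` be an open cell of a
Hausdorff space, `H : P → Y` a continuous map from a finite-dimensional real normed space of
dimension `< n`, `K ⊆ P` compact and `R > 0`.  Then `H` can be changed, only at points mapping
into the chart ball `Φ(B_R)` and only within the image of the chart, to a continuous `H'` which
misses the centre `Φ 0` on `K`.  Proof: in the chart, `k = Φ⁻¹ ∘ H` near `H⁻¹Φ(B̄_{R/2})`
(`chartCollapse`); a smooth `R/8`-approximation `q` of `k` on `K` (the tree's
`Literature.Topology.Euclidean.Brouwer.exists_contDiff_approx`, mollification) and a vector `v`,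
`‖v‖ < R/8`, outside the null set `q(K)` (`exists_norm_lt_not_mem_image`); then
`k' = k + θ(k) (q - v - k)` with the cut-off `θ` (`1` on `B̄_{R/4}`, `0` off `B_{R/2}`) vanishes
nowhere on `K`, and `H' = Φ ∘ k'` on `H⁻¹Φ(B_R)`, `H` elsewhere.  (Rushing (1973), §1.6.D, general
position; here only with respect to a point, via measure rather than polyhedra.) [folklore] -/
theorem exists_perturbation_forall_ne [T2Space Y] {P : Type*} [NormedAddCommGroup P]
    [NormedSpace ℝ P] [FiniteDimensional ℝ P] (hdim : Module.finrank ℝ P < n)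
    {Φ : EuclideanSpace ℝ (Fin n) → Y} (hΦ : IsOpenEmbedding Φ) {H : P → Y} (hH : Continuous H)
    {K : Set P} (hK : IsCompact K) {R : ℝ} (hR : 0 < R) :
    ∃ H' : P → Y, Continuous H' ∧
      (∀ z, H' z ≠ H z → H z ∈ Φ '' ball 0 R ∧ H' z ∈ range Φ) ∧ ∀ z ∈ K, H' z ≠ Φ 0 := by
  classical
  -- the chart coordinate of `H` near `H⁻¹Φ(B̄_R)`
  set k : P → EuclideanSpace ℝ (Fin n) := chartCollapse Φ R ∘ H with hk
  have hkc : Continuous k := (continuous_chartCollapse hΦ R).comp hH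
  have hkΦ : ∀ z x, H z = Φ x → ‖x‖ ≤ R → k z = x := fun z x hzx hx => by
    simp only [hk, comp_apply, hzx, chartCollapse_apply_of_norm_le hΦ.injective hx]
  -- approximation and the avoided vector
  have hR8 : 0 < R / 8 := by positivity
  obtain ⟨q, hq, hqk⟩ := Literature.Topology.Euclidean.Brouwer.exists_contDiff_approx hkc hK hR8
  have hqd : Differentiable ℝ q := hq.differentiable (by simp)
  obtain ⟨v, hv, hvq⟩ := exists_norm_lt_not_mem_image hqd hdim K hR8
  -- the perturbed coordinate
  set k' : P → EuclideanSpace ℝ (Fin n) := fun z => k z + innerCutoff R (k z) • (q z - v - k z)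
    with hk'
  have hk'c : Continuous k' :=
    hkc.add (((continuous_innerCutoff R).comp hkc).smul ((hqd.continuous.sub continuous_const).sub hkc))
  have hk'k : ∀ z, innerCutoff R (k z) = 0 → k' z = k z := fun z hz => by
    simp only [hk', hz, zero_smul, add_zero]
  have hk'K : ∀ z ∈ K, ‖k' z - k z‖ < R / 4 := fun z hz => by
    have h1 : ‖k' z - k z‖ = innerCutoff R (k z) * ‖q z - v - k z‖ := by
      simp only [hk', add_sub_cancel_left, norm_smul,
        Real.norm_of_nonneg (innerCutoff_mem_Icc R (k z)).1]
    have h2 : ‖q z - v - k z‖ ≤ ‖q z - k z‖ + ‖v‖ := by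
      calc ‖q z - v - k z‖ = ‖(q z - k z) - v‖ := by abel_nf
        _ ≤ ‖q z - k z‖ + ‖v‖ := norm_sub_le _ _
    have h3 := hqk z hz
    have h4 := innerCutoff_mem_Icc R (k z)
    rw [h1]
    calc innerCutoff R (k z) * ‖q z - v - k z‖ ≤ 1 * ‖q z - v - k z‖ :=
          mul_le_mul_of_nonneg_right h4.2 (norm_nonneg _)
      _ < R / 4 := by linarith
  -- the perturbed map
  set O : Set P := H ⁻¹' (Φ '' ball 0 R) with hO
  have hOo : IsOpen O := (hΦ.isOpenMap _ isOpen_ball).preimage hH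
  set H' : P → Y := fun z => if z ∈ O then Φ (k' z) else H z with hH'
  have hHO : ∀ z ∈ O, H z = Φ (k z) ∧ ‖k z‖ < R := fun z hz => by
    obtain ⟨x, hx, hxz⟩ := (mem_preimage.1 hz : H z ∈ Φ '' ball 0 R)
    have hxR := mem_ball_zero_iff.1 hx
    have := hkΦ z x hxz.symm hxR.le
    exact ⟨this ▸ hxz.symm, this ▸ hxR⟩
  refine ⟨H', ?_, fun z hz => ?_, fun z hz h0 => ?_⟩
  · -- continuity: `Φ ∘ k'` on `O`, `H` off `H⁻¹Φ(B̄_{R/2})`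
    set F : Set P := H ⁻¹' (Φ '' closedBall 0 (R / 2)) with hF
    have hFc : IsClosed F := ((isCompact_closedBall 0 _).image hΦ.continuous).isClosed.preimage hH
    have hFO : F ⊆ O := preimage_mono (image_mono (closedBall_subset_ball (by linarith)))
    have hon : ∀ z ∈ O, H' z = Φ (k' z) := fun z hz => by simp only [hH', if_pos hz]
    have hoff : ∀ z, z ∉ F → H' z = H z := fun z hz => by
      by_cases hzO : z ∈ O
      · rw [hon z hzO, hk'k z, ← (hHO z hzO).1]
        refine innerCutoff_of_ge hR (le_of_not_gt fun hlt => hz ?_)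
        rw [hF, mem_preimage, (hHO z hzO).1]
        exact ⟨k z, mem_closedBall_zero_iff.2 hlt.le, rfl⟩
      · simp only [hH', if_neg hzO]
    rw [continuous_iff_continuousAt]
    intro z
    by_cases hz : z ∈ O
    · have : H' =ᶠ[𝓝 z] fun z => Φ (k' z) := by
        filter_upwards [hOo.mem_nhds hz] with w hw using hon w hw
      exact (continuousAt_congr this).2 (hΦ.continuous.comp hk'c).continuousAt
    · have hzF : z ∉ F := fun h => hz (hFO h)
      have : H' =ᶠ[𝓝 z] H := by
        filter_upwards [hFc.isOpen_compl.mem_nhds hzF] with w hw using hoff w hw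
      exact (continuousAt_congr this).2 hH.continuousAt
  · -- where `H'` differs from `H`
    by_cases hzO : z ∈ O
    · exact ⟨hzO, by simp only [hH', if_pos hzO]; exact mem_range_self _⟩
    · exact absurd (by simp only [hH', if_neg hzO]) hz
  · -- `H' ≠ Φ 0` on `K`
    by_cases hzO : z ∈ O
    · have h0' : k' z = 0 := hΦ.injective (by simpa only [hH', if_pos hzO] using h0)
      obtain ⟨hHz, hkR⟩ := hHO z hzO
      by_cases h4 : ‖k z‖ ≤ R / 4
      · -- `θ = 1`: `k' z = q z - v`
        have : k' z = q z - v := by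
          simp only [hk', innerCutoff_of_le hR h4, one_smul]
          abel
        rw [this, sub_eq_zero] at h0'
        exact hvq ⟨z, hz, h0'⟩
      · -- `‖k z‖ > R/4 > ‖k' z - k z‖`
        have h5 := hk'K z hz
        rw [h0', zero_sub, norm_neg] at h5
        exact h4 h5.le
    · have : H z = Φ 0 := by simpa only [hH', if_neg hzO] using h0
      exact hzO (by rw [hO, mem_preimage, this]; exact ⟨0, mem_ball_self hR, rfl⟩)

end Literature.Topology.FourManifolds

end
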